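import Summits.CriticalPhenomena.Ising3DConformalLimit.Theses.EnergyNotSigmaSquared
import Literature.Probability.LatticeModels.UrsellFourCurrentsProofs
import Literature.Probability.LatticeModels.AizenmanGrahamInequality

/-!
# Energy factorisation of the truncated pair correlation via sourced double currents

Route `EnergyNotSigmaSquared` of `CriticalPhenomena / Ising3DConformalLimit`, support item
`stmt-CriticalPhenomena-4472` (`EnergyFactorisation`): for the nearest-neighbour Ising model with
free boundary condition and zero field on a finite graph `G`, `β ≥ 0` and vertices `a b x y`,

`⟨σ_aσ_bσ_xσ_y⟩ − ⟨σ_aσ_b⟩⟨σ_xσ_y⟩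
   = ⟨σ_aσ_x⟩⟨σ_bσ_y⟩ · P^{{a}∆{x}} ⊗ P^{{b}∆{y}}[a ↮ b in n₁ + n₂]
   + ⟨σ_aσ_y⟩⟨σ_bσ_x⟩ · P^{{a}∆{y}} ⊗ P^{{b}∆{x}}[a ↮ b in n₁ + n₂]`.

With `(a, b) = (0, e₂)` a bond and `(x, y) = (x, x + e₂)` this is the exact random-current line
for the truncated energy–energy correlation, `⟨ε₀ ; ε_x⟩ = G²·A^par + G'²·A^cross`.

## Proof

Aizenman's identity `U₄(x,y,z,t) = -2 ⟨σ_xσ_y⟩⟨σ_zσ_t⟩ · P^{{x}∆{y}} ⊗ P^{{z}∆{t}}[x ⟷ z]`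
(tree theorem `ursellFour_eq_doubleCurrent_holds`; Aizenman 1982, Prop. 5.1; Duminil-Copin 2016,
eq. (24); Aizenman–Duminil-Copin 2021, eq. (3.11)) is applied to the two labellings `(a,x,b,y)` and
`(a,y,b,x)`; `U₄` is symmetric (the four-point monomial via `isingExpect_spinMonomial_four_eq`,
the pair correlator via `isingTwoPoint_symm`), so averaging gives
`U₄(a,b,x,y) = -⟨σ_aσ_x⟩⟨σ_bσ_y⟩ P^{ax,by}[a ⟷ b] - ⟨σ_aσ_y⟩⟨σ_bσ_x⟩ P^{ay,bx}[a ⟷ b]`, i.e.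
`⟨σ_aσ_bσ_xσ_y⟩ − ⟨σ_aσ_b⟩⟨σ_xσ_y⟩ = ⟨σ_aσ_x⟩⟨σ_bσ_y⟩(1 - P^{ax,by}[a ⟷ b]) + ⟨σ_aσ_y⟩⟨σ_bσ_x⟩(1 - P^{ay,bx}[a ⟷ b])`.
Finally `⟨σ_uσ_v⟩⟨σ_u'σ_v'⟩ · P[Eᶜ] = ⟨σ_uσ_v⟩⟨σ_u'σ_v'⟩ · (1 - P[E])`
(`twoPoint_mul_doubleCurrent_real_compl`): if the prefactor vanishes both sides are `0`;
otherwise `Z_{{u}∆{v}}, Z_{{u'}∆{v'}} ≠ 0` (`⟨σ_uσ_v⟩ = Z_{{u}∆{v}}/Z_∅`,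
`isingTwoPoint_free_eq_currentSum_div_holds`) and the double-current measure is a probability
measure (`isProbabilityMeasure_doubleCurrentMeasure_holds`).

## References

* M. Aizenman, *Geometric analysis of φ⁴ fields and Ising models*, Comm. Math. Phys. 86 (1982),
  Prop. 5.1–5.2 [AizenmanCMP1982].
* H. Duminil-Copin, *Random currents expansion of the Ising model*, arXiv:1607.06933 (2016),
  §4.3 eq. (24) [DuminilCopin2016].
* M. Aizenman, H. Duminil-Copin, Ann. of Math. 194 (2021), eq. (3.11)
  [AizenmanDuminilCopinAnnals2021].
-/

noncomputable section

namespace Summit.CriticalPhenomena.Ising3DConformalLimit.Theorems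

open MeasureTheory Finset
open scoped symmDiff
open Literature.Probability.LatticeModels

variable {V : Type*} [Fintype V] [DecidableEq V] (G : SimpleGraph V) [DecidableRel G.Adj]

/-- Complement rule with the two-point prefactor, free of non-degeneracy hypotheses: for `β ≥ 0`,
`⟨σ_uσ_v⟩⟨σ_u'σ_v'⟩ · P^{{u}∆{v}} ⊗ P^{{u'}∆{v'}}[Eᶜ] = ⟨σ_uσ_v⟩⟨σ_u'σ_v'⟩ · (1 - P^{{u}∆{v}} ⊗ P^{{u'}∆{v'}}[E])`.
If the prefactor vanishes both sides are `0`; otherwise `Z_{{u}∆{v}} Z_{{u'}∆{v'}} ≠ 0`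
(random-current representation `⟨σ_uσ_v⟩ = Z_{{u}∆{v}}/Z_∅`) and the double-current measure is a
probability measure (Duminil-Copin 2016, §2.2). [folklore] -/
theorem twoPoint_mul_doubleCurrent_real_compl {β : ℝ} (hβ : 0 ≤ β) (u v u' v' : V)
    {E : Set (Current G × Current G)} (hE : MeasurableSet E) :
    isingTwoPoint G univ β 0 .free u v * isingTwoPoint G univ β 0 .free u' v' *
        (doubleCurrentMeasure G β ({u} ∆ {v}) ({u'} ∆ {v'})).real Eᶜ =
      isingTwoPoint G univ β 0 .free u v * isingTwoPoint G univ β 0 .free u' v' *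
        (1 - (doubleCurrentMeasure G β ({u} ∆ {v}) ({u'} ∆ {v'})).real E) := by
  by_cases h0 : isingTwoPoint G univ β 0 .free u v * isingTwoPoint G univ β 0 .free u' v' = 0
  · rw [h0, zero_mul, zero_mul]
  · have huv : currentSum G β ({u} ∆ {v}) ≠ 0 := by
      intro h
      apply h0
      rw [isingTwoPoint_free_eq_currentSum_div_holds G β u v, h, zero_div, zero_mul]
    have hu'v' : currentSum G β ({u'} ∆ {v'}) ≠ 0 := by
      intro h
      apply h0
      rw [isingTwoPoint_free_eq_currentSum_div_holds G β u' v', h, zero_div, mul_zero]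
    haveI := isProbabilityMeasure_doubleCurrentMeasure_holds G hβ huv hu'v'
    rw [probReal_compl_eq_one_sub hE]

/-- **Energy factorisation** (settles `stmt-CriticalPhenomena-4472`, exact signature of
`Theses.EnergyNotSigmaSquared.EnergyFactorisation`): for the nearest-neighbour Ising model with
free boundary condition and zero field on any finite graph `G`, `β ≥ 0` and vertices `a b x y`,
`⟨σ_aσ_bσ_xσ_y⟩ − ⟨σ_aσ_b⟩⟨σ_xσ_y⟩ = ⟨σ_aσ_x⟩⟨σ_bσ_y⟩·P^{{a}∆{x}}⊗P^{{b}∆{y}}[a ↮ b]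
  + ⟨σ_aσ_y⟩⟨σ_bσ_x⟩·P^{{a}∆{y}}⊗P^{{b}∆{x}}[a ↮ b]`
— Aizenman's double-current identity for `U₄` (`ursellFour_eq_doubleCurrent_holds`) averaged
over the two cross pairings (Aizenman 1982, Prop. 5.1; Duminil-Copin 2016, eq. (24);
Aizenman–Duminil-Copin 2021, eq. (3.11)). [folklore] -/
theorem EnergyFactorisation_proof :
    Summit.CriticalPhenomena.Ising3DConformalLimit.Theses.EnergyNotSigmaSquared.EnergyFactorisation := by
  unfold Summit.CriticalPhenomena.Ising3DConformalLimit.Theses.EnergyNotSigmaSquared.EnergyFactorisation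
  intro V _ _ G _ β hβ a b x y
  have h1 := ursellFour_eq_doubleCurrent_holds G hβ a x b y
  have h2 := ursellFour_eq_doubleCurrent_holds G hβ a y b x
  simp only [connectedFour, nPoint_isingMeasure, twoPoint_isingMeasure, Matrix.cons_val] at h1 h2
  rw [nPoint_isingMeasure]
  -- the four-point monomials agree: `σ_aσ_xσ_bσ_y = σ_aσ_yσ_bσ_x = σ_aσ_bσ_xσ_y = σ_S`
  rw [isingExpect_spinMonomial_four_eq] at h1 h2 ⊢
  have e1 : ({a} : Finset V) ∆ ({x} ∆ ({b} ∆ {y})) = {a} ∆ ({b} ∆ ({x} ∆ {y})) := by ac_rfl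
  have e2 : ({a} : Finset V) ∆ ({y} ∆ ({b} ∆ {x})) = {a} ∆ ({b} ∆ ({x} ∆ {y})) := by ac_rfl
  rw [e1, isingTwoPoint_symm G univ β 0 .free x b] at h1
  rw [e2, isingTwoPoint_symm G univ β 0 .free y x, isingTwoPoint_symm G univ β 0 .free y b] at h2
  -- complements: `P[a ↮ b] = 1 - P[a ⟷ b]` wherever the two-point prefactor is non-zero
  rw [twoPoint_mul_doubleCurrent_real_compl G hβ a x b y (measurableSet_tracedConn G a b),
    twoPoint_mul_doubleCurrent_real_compl G hβ a y b x (measurableSet_tracedConn G a b)]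
  linear_combination (h1 + h2) / 2

end Summit.CriticalPhenomena.Ising3DConformalLimit.Theorems

end
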